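import Summits.ResolutionOfSingularities.ResolutionOfSingularities.Theses.SharpStrata
import Literature.AlgebraicGeometry.Resolution.AlterationsResolution
import HarnessLib

/-!
# Route `SharpStrata`, crux `ResSepExc` — the predicates and the two stub statements of the line
# `registered` (`Cruxes/ResSepExc/Lines/birth.lean`), by name, with their calibration

Route file: `Summits/ResolutionOfSingularities/ResolutionOfSingularities/Theses/SharpStrata.lean`
(items `SepExcModels`, stmt-16828, and `ResSepExc`, stmt-16829). Both items inline one and the
same `let SepExc := …` because no named predicate existed when the route was opened, and the
crux line `Cruxes/ResSepExc/Lines/birth.lean` (lead: this file's author) cuts `ResSepExc` into two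
registered stubs over a second predicate `IsolatedSing`. This file gives all four statements
tree names, so that stubs, partial results and the eventual promotion of a stub to an item can
refer to them BY NAME, and records the kernel-checked calibration of the cut:

* `SepExc Y` — **separably exceptional** (verbatim the route's `let SepExc`): every point `ζ` of
  the integral scheme `Y` is regular, or closed, or admits a finitely generated birational local
  model `B = 𝒪_{Y,ζ}[s] ⊆ K(Y)` with a prime `𝔮` over `𝔪_ζ` such that `B_𝔮` is regular and `B/𝔮`
  is generically smooth over `κ(ζ)` — a prime divisor over `ζ` with separably generated residue
  field, which makes `Y` arc-blunt at `ζ` (Benito–Piltant–Reguera 2022, Lemma 4.2, Prop. 4.3,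
  Thm. 4.4). `resSepExc_iff`, `sepExcModels_iff` (`Iff.rfl`) certify that it IS the route's `let`.
* `IsolatedSing Y` — **isolated singularities**: every point of `Y` is regular or closed
  (verbatim the first two disjuncts of `SepExc`; for `Y` of finite type over a field: the
  non-regular locus is a set of closed points, hence finite — the hypothesis shape of
  `Literature/AlgebraicGeometry/Resolution/HilbertSamuelIsolatedSingularities.lean`).
* `IsolatedModelsInChar p` — statement of the stub `stub_isolateSingularities` at the prime `p`
  (stratum-generic phase): over every perfect field of characteristic `p`, every separably
  exceptional integral separated scheme of finite type has a proper birational INTEGRAL model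
  with isolated singularities. Open from dimension `4` (patching / termination of spread-out
  local resolutions: Cossart–Piltant 2019, §1; in dimension `≥ 5` the local input — resolution of
  excellent local rings of dimension `≥ 4` — is itself open).
* `ResolutionOfIsolatedInChar p` — statement of the stub `stub_isolatedResolution` at `p`
  (closed-point phase): over every perfect field of characteristic `p`, every integral separated
  scheme of finite type with isolated singularities has a resolution of singularities. Open from
  dimension `4` (Kollár 2007, Ch. 3); dimension `≤ 3` is Cossart–Piltant 2019 (tree fact
  `CossartPiltant2019`).
* Calibration (all PROVED, axioms `propext`/`Classical.choice`/`Quot.sound`):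
  `resSepExc_of` — **the cut closes the crux**: `(∀ p prime, IsolatedModelsInChar p) →
  (∀ p prime, ResolutionOfIsolatedInChar p) → ResSepExc` (take the isolated-singularity model,
  resolve it, transport the resolution down the proper birational map with
  `ComponentGluing.Scheme.HasResolution.of_isBirational`);
  `resolutionOfIsolatedInChar_of_resSepExc` — **the crux dominates the closed-point stub**
  (`IsolatedSing ⇒ SepExc`), so that stub is crux-sized by construction;
  `resolutionOfIsolatedInChar_of_resolutionInChar`, `isolatedModelsInChar_of_resolutionInChar`,
  `stubs_of_resolutionOfSingularities` — **lossless**: resolution in characteristic `p` (a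
  fortiori the summit) implies both stub statements, so neither is refutable short of refuting
  `ResolutionOfSingularities`.

What is NOT here: any proof of either stub statement (both are open problems from dimension 4).
-/

noncomputable section

-- single-problem summit: the doubled namespace component `ResolutionOfSingularities` is forced
set_option linter.dupNamespace false

open CategoryTheory AlgebraicGeometry Literature.AlgebraicGeometry.Resolution

namespace Summit.ResolutionOfSingularities.ResolutionOfSingularities.Theorems.SharpStrata

/-! ## The two predicates -/

/-- **Separably exceptional** integral scheme (route `SharpStrata`; verbatim the `let SepExc` of
the route items `SepExcModels` / `ResSepExc`): every point `ζ` of `Y` is regular, or closed, or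
has a finitely generated birational local model `B = 𝒪_{Y,ζ}[s] ⊆ K(Y)` (`s` a finite set of
rational functions) with a prime `𝔮` lying over `𝔪_ζ` such that `B_𝔮` is a regular local ring and
`B/𝔮` is generically smooth over the residue field `κ(ζ) = 𝒪_{Y,ζ}/𝔪_ζ` (some basic open
`D(g)`, `g ∉ 𝔮`, of `Spec (B/𝔮)` is smooth over `κ(ζ)`). Informally: over every non-closed
singular point there is a prime divisor with separably generated residue field — the hypothesis
of Benito–Piltant–Reguera's bluntness criterion.
[cite: BenitoPiltantReguera2022, Prop. 4.3] -/
def SepExc (Y : Scheme.{0}) [IsIntegral Y] : Prop :=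
  ∀ ζ : Y, IsRegularLocalRing (Y.presheaf.stalk ζ) ∨ IsClosed ({ζ} : Set Y) ∨ ∃ (s : Finset Y.functionField) (𝔮 : Ideal (Algebra.adjoin (Y.presheaf.stalk ζ) (s : Set Y.functionField))) (_ : 𝔮.IsPrime) (hle : IsLocalRing.maximalIdeal (Y.presheaf.stalk ζ) ≤ 𝔮.comap (algebraMap (Y.presheaf.stalk ζ) (Algebra.adjoin (Y.presheaf.stalk ζ) (s : Set Y.functionField)))), IsRegularLocalRing (Localization.AtPrime 𝔮) ∧ ∃ g : Algebra.adjoin (Y.presheaf.stalk ζ) (s : Set Y.functionField), g ∉ 𝔮 ∧ (letI := ((algebraMap _ (Localization.Away (Ideal.Quotient.mk 𝔮 g))).comp (Ideal.quotientMap 𝔮 (algebraMap (Y.presheaf.stalk ζ) (Algebra.adjoin (Y.presheaf.stalk ζ) (s : Set Y.functionField))) hle)).toAlgebra; Algebra.Smooth (Y.presheaf.stalk ζ ⧸ IsLocalRing.maximalIdeal (Y.presheaf.stalk ζ)) (Localization.Away (Ideal.Quotient.mk 𝔮 g)))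

/-- **Isolated singularities**: every point of the scheme `Y` is regular (its local ring is a
regular local ring) or is a closed point. For `Y` of finite type over a field: the non-regular
locus consists of closed points (hence is finite). Verbatim the first two disjuncts of `SepExc`.
[cite: Kollar2007, Ch. 3] -/
def IsolatedSing (Y : Scheme.{0}) : Prop :=
  ∀ ζ : Y, IsRegularLocalRing (Y.presheaf.stalk ζ) ∨ IsClosed ({ζ} : Set Y)

/-- The route item `ResSepExc` (stmt-ResolutionOfSingularities-16829) unfolds to: over every
perfect field of prime characteristic, every separably exceptional (`SepExc`) integral separated
scheme of finite type has a resolution of singularities (`Iff.rfl`: `SepExc` is literally the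
route's `let`). [folklore] -/
theorem resSepExc_iff :
    Theses.SharpStrata.ResSepExc ↔
      ∀ p : ℕ, p.Prime → ∀ (k : Type) [Field k] [CharP k p] [PerfectField k] (X : Scheme.{0})
        [IsIntegral X] (f : X ⟶ Spec (.of k)), IsSeparated f → LocallyOfFiniteType f →
        QuasiCompact f → SepExc X → Scheme.HasResolution X :=
  Iff.rfl

/-- The route item `SepExcModels` (stmt-ResolutionOfSingularities-16828) unfolds to: over every
perfect field of prime characteristic, every integral separated scheme of finite type has a
proper birational integral model which is separably exceptional (`Iff.rfl`). [folklore] -/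
theorem sepExcModels_iff :
    Theses.SharpStrata.SepExcModels ↔
      ∀ p : ℕ, p.Prime → ∀ (k : Type) [Field k] [CharP k p] [PerfectField k] (X : Scheme.{0})
        [IsIntegral X] (f : X ⟶ Spec (.of k)), IsSeparated f → LocallyOfFiniteType f →
        QuasiCompact f → ∃ (X' : Scheme.{0}) (_ : IsIntegral X') (π : X' ⟶ X),
          IsProper π ∧ IsBirational π ∧ SepExc X' :=
  Iff.rfl

/-- Varieties with isolated singularities are separably exceptional (vacuously: there is no
non-closed singular point to certify). [folklore] -/
theorem IsolatedSing.sepExc {Y : Scheme.{0}} [IsIntegral Y] (h : IsolatedSing Y) : SepExc Y :=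
  fun ζ => (h ζ).elim Or.inl fun hc => Or.inr (Or.inl hc)

/-- A regular scheme has isolated singularities (none at all). [folklore] -/
theorem isolatedSing_of_isRegular {Y : Scheme.{0}} (h : Scheme.IsRegular Y) : IsolatedSing Y :=
  fun ζ => Or.inl (h ζ)

/-- A regular integral scheme is separably exceptional. [folklore] -/
theorem sepExc_of_isRegular {Y : Scheme.{0}} [IsIntegral Y] (h : Scheme.IsRegular Y) :
    SepExc Y :=
  (isolatedSing_of_isRegular h).sepExc

/-! ## The two stub statements of the line, by name -/

/-- **Isolated-singularity models in characteristic `p`** (the statement of the registered stub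
`stub_isolateSingularities` of the line `registered` at the prime `p`; the stratum-generic
phase): for every perfect field `k` of characteristic `p` and every separably exceptional
integral separated `k`-scheme `X` of finite type there are an integral `X'` and a proper
birational `π : X' → X` such that `X'` has isolated singularities. Implied by resolution in
characteristic `p` (`isolatedModelsInChar_of_resolutionInChar`); open from dimension `4`
(patching / termination of spread-out local resolutions, Cossart–Piltant 2019, §1).
[cite: BenitoPiltantReguera2022, Lemma 4.2] -/
def IsolatedModelsInChar (p : ℕ) : Prop :=
  ∀ (k : Type) [Field k] [CharP k p] [PerfectField k] (X : Scheme.{0}) [IsIntegral X]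
    (f : X ⟶ Spec (.of k)), IsSeparated f → LocallyOfFiniteType f → QuasiCompact f → SepExc X →
    ∃ (X' : Scheme.{0}) (_ : IsIntegral X') (π : X' ⟶ X),
      IsProper π ∧ IsBirational π ∧ IsolatedSing X'

/-- **Resolution of isolated singularities in characteristic `p` over perfect fields** (the
statement of the registered stub `stub_isolatedResolution` of the line `registered` at the prime
`p`; the closed-point phase): for every perfect field `k` of characteristic `p`, every integral
separated `k`-scheme of finite type all of whose non-regular points are closed has a resolution
of singularities. Implied by the crux `ResSepExc` itself
(`resolutionOfIsolatedInChar_of_resSepExc`) and by resolution in characteristic `p`; known in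
dimension `≤ 3` (Cossart–Piltant 2019), open from dimension `4`.
[cite: Kollar2007, Ch. 3] -/
def ResolutionOfIsolatedInChar (p : ℕ) : Prop :=
  ∀ (k : Type) [Field k] [CharP k p] [PerfectField k] (X : Scheme.{0}) [IsIntegral X]
    (f : X ⟶ Spec (.of k)), IsSeparated f → LocallyOfFiniteType f → QuasiCompact f →
    IsolatedSing X → Scheme.HasResolution X

/-! ## Calibration of the cut (proved) -/

/-- **The cut closes the crux.** If separably exceptional varieties admit proper birational
integral models with isolated singularities, and varieties with isolated singularities are
resolvable (both over perfect fields of every prime characteristic), then `ResSepExc` holds: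
resolve the model `X'` (its structure map `π ≫ f` is separated, locally of finite type and
quasi-compact since `π` is proper) and transport the resolution down the proper birational `π`
(`ComponentGluing.Scheme.HasResolution.of_isBirational`). This is the composition `ResSepExc_of`
of the registered skeleton `Cruxes/ResSepExc/Lines/birth.lean`. [folklore] -/
theorem resSepExc_of (h₁ : ∀ p : ℕ, p.Prime → IsolatedModelsInChar p)
    (h₂ : ∀ p : ℕ, p.Prime → ResolutionOfIsolatedInChar p) : Theses.SharpStrata.ResSepExc := by
  intro p hp k _ _ _ X _ f hs hl hq hX
  obtain ⟨X', hX', π, hπ, hb, hiso⟩ := h₁ p hp k X f hs hl hq hX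
  haveI := hX'; haveI := hπ; haveI := hs; haveI := hl; haveI := hq
  refine ComponentGluing.Scheme.HasResolution.of_isBirational π hb ?_
  exact h₂ p hp k X' (π ≫ f) inferInstance inferInstance inferInstance hiso

/-- **The crux dominates the closed-point stub**: `ResSepExc` implies resolution of isolated
singularities over perfect fields in every prime characteristic (a variety with isolated
singularities is separably exceptional, `IsolatedSing.sepExc`). Hence the stub
`stub_isolatedResolution` is exactly as hard as a special case of the crux. [folklore] -/
theorem resolutionOfIsolatedInChar_of_resSepExc (h : Theses.SharpStrata.ResSepExc) {p : ℕ}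
    (hp : p.Prime) : ResolutionOfIsolatedInChar p :=
  fun k _ _ _ X _ f hs hl hq hX => h p hp k X f hs hl hq hX.sepExc

/-- Resolution of singularities in characteristic `p` implies resolution of isolated
singularities over perfect fields of characteristic `p` (an integral scheme is reduced).
[folklore] -/
theorem resolutionOfIsolatedInChar_of_resolutionInChar {p : ℕ} (h : ResolutionInChar.{0} p) :
    ResolutionOfIsolatedInChar p :=
  fun k _ _ _ X _ f hs hl hq _ => h k X f hs hl hq inferInstance

/-- Resolution of singularities in characteristic `p` implies the existence of
isolated-singularity models in characteristic `p`: a resolution `π : X' → X` is such a model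
(`X'` is integral, being reduced — `Scheme.IsRegular.isReduced` — and birational over the
integral `X`, `IsBirational.isIntegral`; a regular scheme has isolated singularities).
[folklore] -/
theorem isolatedModelsInChar_of_resolutionInChar {p : ℕ} (h : ResolutionInChar.{0} p) :
    IsolatedModelsInChar p := by
  intro k _ _ _ X _ f hs hl hq _
  obtain ⟨X', π, hπ⟩ := h k X f hs hl hq inferInstance
  haveI : IsReduced X' := hπ.isRegular.isReduced
  exact ⟨X', hπ.isBirational.isIntegral, π, hπ.isProper, hπ.isBirational,
    isolatedSing_of_isRegular hπ.isRegular⟩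

/-- **Lossless cut**: the summit `ResolutionOfSingularities` implies both stub statements in
every prime characteristic, so neither stub is refutable short of refuting the summit (the same
two-sidedness as the route's `Lossless` item). [folklore] -/
theorem stubs_of_resolutionOfSingularities (h : _root_.ResolutionOfSingularities) :
    (∀ p : ℕ, p.Prime → IsolatedModelsInChar p) ∧
      (∀ p : ℕ, p.Prime → ResolutionOfIsolatedInChar p) :=
  ⟨fun p hp => isolatedModelsInChar_of_resolutionInChar ((ResolutionOfSingularities_iff.mp h) p hp),
    fun p hp =>
      resolutionOfIsolatedInChar_of_resolutionInChar ((ResolutionOfSingularities_iff.mp h) p hp)⟩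

end Summit.ResolutionOfSingularities.ResolutionOfSingularities.Theorems.SharpStrata

end
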